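import Summits.AtomisticToContinuum.Crystallization.Theorems.FrustratedLawDichotomyForceRemainder

/-!
# FrustratedLawDichotomy · residual crux `AperiodicFrustratedLawGap` (stmt-AtomisticToContinuum-27623) — the LJ PAIR-ENERGY THIRD-ORDER REMAINDER (T2 ingredient, host-independent)
# (hdef side, class A: the energy side of the window expansion — first-order term = NODE-9's linear functional, second-order term = the harmonic form of R5, remainder = the
# A₂ column; decomp-a2c lens-5 g111 NODE-12; companion of NODE-10 `…ForceRemainder` and NODE-11 `…WindowSymmetry`)

In the squared-length variable `t = ‖x‖²` the Lennard–Jones pair energy of the tree, `lennardJones r = (1/12) r⁻¹^12 - (1/6) r⁻¹^6`, is the RATIONAL function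
`φ t = (1/12) t⁻¹^6 - (1/6) t⁻¹^3` (`inv_sq_pow_eq`), with `2 φ′ = ψ` (the force profile of NODE-10) and `φ″ t = (7/2) t⁻¹^8 - 2 t⁻¹^5`.  This file books the expansion of a
bond energy under an endpoint displacement `δ` to SECOND order with an exact, explicitly bounded THIRD-order remainder:

* `inv_pow_three_taylor₃`, `inv_pow_six_taylor₃` — exact identities `t₁⁻¹^k - [t₀⁻¹^k - k t₀⁻¹^(k+1) Δ + (k(k+1)/2) t₀⁻¹^(k+2) Δ²] = -Δ³ · C_k(t₀,t₁)` (k = 3, 6; third divided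
  differences, `C_k` an explicit positive combination) and `0 ≤ C₃ ≤ 10 ρ⁻¹^6`, `0 ≤ C₆ ≤ 56 ρ⁻¹^9` on `ρ ≤ t₀, t₁`;
* `phi_taylor₃_abs_le` — `|φ t₁ - φ t₀ - φ′ t₀ Δ - ½ φ″ t₀ Δ²| ≤ max ((14/3) ρ⁻¹^9) ((5/3) ρ⁻¹^6) · |Δ|³`;
* `bond_energy_expansion_eq` — with `Δ = ‖n + δ‖² - ‖n‖² = 2⟪n,δ⟫ + ‖δ‖²` and ARBITRARY scalars `a = φ₀, b = φ₁, c = φ′₀, d = φ″₀`: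
  `b - a - (2c) ⟪n,δ⟫ - (c ‖δ‖² + 2 d ⟪n,δ⟫²) = [b - a - c Δ - ½ d Δ²] + d (2⟪n,δ⟫ ‖δ‖² + ½ ‖δ‖⁴)` — the bracket is the scalar remainder, the rest is explicit cubic/quartic;
* ★ `abs_bond_energy_remainder_le` — `0 < ρ ≤ ‖n‖², ‖n+δ‖²` ⊢ `|φ(‖n+δ‖²) - φ(‖n‖²) - ψ(‖n‖²) ⟪n,δ⟫ - (φ′(‖n‖²) ‖δ‖² + 2 φ″(‖n‖²) ⟪n,δ⟫²)| ≤ max((14/3)ρ⁻¹^9)((5/3)ρ⁻¹^6) (2‖n‖‖δ‖ + ‖δ‖²)³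
  + |φ″(‖n‖²)| (2‖n‖‖δ‖³ + ½‖δ‖⁴)` — cubic in `‖δ‖`: the per-bond `A₂`-remainder with explicit constants (≈ 44 ‖δ‖³ at unit bonds).

DEF-FREE; imports only the tree companion (209) `…ForceRemainder` (for `inv_pow_le_inv_pow`, `abs_norm_add_sq_sub_le`); general real inner-product space. [folklore: Taylor remainders of rational radial profiles via divided differences]
-/

namespace Summit.AtomisticToContinuum.Crystallization.Theorems.FrustratedLawDichotomyEnergyRemainder

open RealInnerProductSpace
open Summit.AtomisticToContinuum.Crystallization.Theorems.FrustratedLawDichotomyForceRemainder (inv_pow_le_inv_pow abs_norm_add_sq_sub_le)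

/-! ## Scalar part -/

/-- Bridge to the tree's distance variable: `(r²)⁻¹ ^ k = r⁻¹ ^ (2k)`. [folklore] -/
theorem inv_sq_pow_eq (r : ℝ) (k : ℕ) : (r ^ 2)⁻¹ ^ k = r⁻¹ ^ (2 * k) := by
  rw [inv_pow, inv_pow, ← pow_mul]

/-- Hence `(1/12)(r²)⁻¹^6 - (1/6)(r²)⁻¹^3 = (1/12) r⁻¹^12 - (1/6) r⁻¹^6` (= `lennardJones r` of the tree). [folklore] -/
theorem phi_sq_eq (r : ℝ) : (1 / 12 : ℝ) * (r ^ 2)⁻¹ ^ 6 - 1 / 6 * (r ^ 2)⁻¹ ^ 3 = 1 / 12 * r⁻¹ ^ 12 - 1 / 6 * r⁻¹ ^ 6 := by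
  rw [inv_sq_pow_eq, inv_sq_pow_eq]

/-- Products of two monomial inverse-power bounds. [folklore] -/
theorem inv_pow_mul_inv_pow_le {ρ t₀ t₁ : ℝ} (hρ : 0 < ρ) (h₀ : ρ ≤ t₀) (h₁ : ρ ≤ t₁) (m n : ℕ) :
    0 ≤ t₀⁻¹ ^ m * t₁⁻¹ ^ n ∧ t₀⁻¹ ^ m * t₁⁻¹ ^ n ≤ ρ⁻¹ ^ (m + n) := by
  have a0 : 0 ≤ t₀⁻¹ := inv_nonneg.mpr (hρ.le.trans h₀)
  have b0 : 0 ≤ t₁⁻¹ := inv_nonneg.mpr (hρ.le.trans h₁)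
  exact ⟨mul_nonneg (pow_nonneg a0 m) (pow_nonneg b0 n), by
    rw [pow_add]
    exact mul_le_mul (inv_pow_le_inv_pow hρ h₀ m) (inv_pow_le_inv_pow hρ h₁ n) (pow_nonneg b0 n) (pow_nonneg (inv_nonneg.mpr hρ.le) m)⟩

/-- exact third-order identity for `t⁻¹ ^ 3`. [folklore] -/
theorem inv_pow_three_taylor₃ {t₀ t₁ : ℝ} (h₀ : t₀ ≠ 0) (h₁ : t₁ ≠ 0) :
    t₁⁻¹ ^ 3 - t₀⁻¹ ^ 3 + 3 * t₀⁻¹ ^ 4 * (t₁ - t₀) - 6 * t₀⁻¹ ^ 5 * (t₁ - t₀) ^ 2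
      = -((t₁ - t₀) ^ 3 * (t₀⁻¹ ^ 3 * t₁⁻¹ ^ 3 + 3 * (t₀⁻¹ ^ 4 * t₁⁻¹ ^ 2) + 6 * (t₀⁻¹ ^ 5 * t₁⁻¹))) := by
  field_simp
  ring

/-- exact third-order identity for `t⁻¹ ^ 6`. [folklore] -/
theorem inv_pow_six_taylor₃ {t₀ t₁ : ℝ} (h₀ : t₀ ≠ 0) (h₁ : t₁ ≠ 0) :
    t₁⁻¹ ^ 6 - t₀⁻¹ ^ 6 + 6 * t₀⁻¹ ^ 7 * (t₁ - t₀) - 21 * t₀⁻¹ ^ 8 * (t₁ - t₀) ^ 2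
      = -((t₁ - t₀) ^ 3 * (t₀⁻¹ ^ 3 * t₁⁻¹ ^ 6 + 3 * (t₀⁻¹ ^ 4 * t₁⁻¹ ^ 5) + 6 * (t₀⁻¹ ^ 5 * t₁⁻¹ ^ 4)
          + 10 * (t₀⁻¹ ^ 6 * t₁⁻¹ ^ 3) + 15 * (t₀⁻¹ ^ 7 * t₁⁻¹ ^ 2) + 21 * (t₀⁻¹ ^ 8 * t₁⁻¹))) := by
  field_simp
  ring

/-- `0 ≤ C₃ ≤ 10 ρ⁻⁶`. [folklore] -/
theorem inv_pow_three_taylor₃_le {ρ t₀ t₁ : ℝ} (hρ : 0 < ρ) (h₀ : ρ ≤ t₀) (h₁ : ρ ≤ t₁) :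
    0 ≤ t₀⁻¹ ^ 3 * t₁⁻¹ ^ 3 + 3 * (t₀⁻¹ ^ 4 * t₁⁻¹ ^ 2) + 6 * (t₀⁻¹ ^ 5 * t₁⁻¹) ∧
    t₀⁻¹ ^ 3 * t₁⁻¹ ^ 3 + 3 * (t₀⁻¹ ^ 4 * t₁⁻¹ ^ 2) + 6 * (t₀⁻¹ ^ 5 * t₁⁻¹) ≤ 10 * ρ⁻¹ ^ 6 := by
  have e1 := inv_pow_mul_inv_pow_le hρ h₀ h₁ 3 3
  have e2 := inv_pow_mul_inv_pow_le hρ h₀ h₁ 4 2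
  have e3 := inv_pow_mul_inv_pow_le hρ h₀ h₁ 5 1
  simp only [pow_one] at e3
  constructor <;> nlinarith [e1.1, e1.2, e2.1, e2.2, e3.1, e3.2]

/-- `0 ≤ C₆ ≤ 56 ρ⁻⁹`. [folklore] -/
theorem inv_pow_six_taylor₃_le {ρ t₀ t₁ : ℝ} (hρ : 0 < ρ) (h₀ : ρ ≤ t₀) (h₁ : ρ ≤ t₁) :
    0 ≤ t₀⁻¹ ^ 3 * t₁⁻¹ ^ 6 + 3 * (t₀⁻¹ ^ 4 * t₁⁻¹ ^ 5) + 6 * (t₀⁻¹ ^ 5 * t₁⁻¹ ^ 4)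
          + 10 * (t₀⁻¹ ^ 6 * t₁⁻¹ ^ 3) + 15 * (t₀⁻¹ ^ 7 * t₁⁻¹ ^ 2) + 21 * (t₀⁻¹ ^ 8 * t₁⁻¹) ∧
    t₀⁻¹ ^ 3 * t₁⁻¹ ^ 6 + 3 * (t₀⁻¹ ^ 4 * t₁⁻¹ ^ 5) + 6 * (t₀⁻¹ ^ 5 * t₁⁻¹ ^ 4)
          + 10 * (t₀⁻¹ ^ 6 * t₁⁻¹ ^ 3) + 15 * (t₀⁻¹ ^ 7 * t₁⁻¹ ^ 2) + 21 * (t₀⁻¹ ^ 8 * t₁⁻¹) ≤ 56 * ρ⁻¹ ^ 9 := by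
  have e1 := inv_pow_mul_inv_pow_le hρ h₀ h₁ 3 6
  have e2 := inv_pow_mul_inv_pow_le hρ h₀ h₁ 4 5
  have e3 := inv_pow_mul_inv_pow_le hρ h₀ h₁ 5 4
  have e4 := inv_pow_mul_inv_pow_le hρ h₀ h₁ 6 3
  have e5 := inv_pow_mul_inv_pow_le hρ h₀ h₁ 7 2
  have e6 := inv_pow_mul_inv_pow_le hρ h₀ h₁ 8 1
  simp only [pow_one] at e6
  constructor <;> nlinarith [e1.1, e1.2, e2.1, e2.2, e3.1, e3.2, e4.1, e4.2, e5.1, e5.2, e6.1, e6.2]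

/-- Third-order Taylor bound for `φ t = (1/12) t⁻¹^6 - (1/6) t⁻¹^3` (`φ′ t = -(1/2) t⁻¹^7 + (1/2) t⁻¹^4`, `½ φ″ t = (7/4) t⁻¹^8 - t⁻¹^5`):
`|φ t₁ - φ t₀ - φ′ t₀ Δ - ½ φ″ t₀ Δ²| ≤ max ((14/3) ρ⁻¹^9) ((5/3) ρ⁻¹^6) · |Δ|³`. [folklore] -/
theorem phi_taylor₃_abs_le {ρ t₀ t₁ : ℝ} (hρ : 0 < ρ) (h₀ : ρ ≤ t₀) (h₁ : ρ ≤ t₁) :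
    |(1 / 12 * t₁⁻¹ ^ 6 - 1 / 6 * t₁⁻¹ ^ 3) - (1 / 12 * t₀⁻¹ ^ 6 - 1 / 6 * t₀⁻¹ ^ 3)
        - (-(1 / 2) * t₀⁻¹ ^ 7 + 1 / 2 * t₀⁻¹ ^ 4) * (t₁ - t₀) - (7 / 4 * t₀⁻¹ ^ 8 - t₀⁻¹ ^ 5) * (t₁ - t₀) ^ 2|
      ≤ max (14 / 3 * ρ⁻¹ ^ 9) (5 / 3 * ρ⁻¹ ^ 6) * |t₁ - t₀| ^ 3 := by
  have ht₀ : t₀ ≠ 0 := (hρ.trans_le h₀).ne'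
  have ht₁ : t₁ ≠ 0 := (hρ.trans_le h₁).ne'
  have i3 := inv_pow_three_taylor₃ ht₀ ht₁
  have i6 := inv_pow_six_taylor₃ ht₀ ht₁
  obtain ⟨c3l, c3u⟩ := inv_pow_three_taylor₃_le hρ h₀ h₁
  obtain ⟨c6l, c6u⟩ := inv_pow_six_taylor₃_le hρ h₀ h₁
  set C₃ := t₀⁻¹ ^ 3 * t₁⁻¹ ^ 3 + 3 * (t₀⁻¹ ^ 4 * t₁⁻¹ ^ 2) + 6 * (t₀⁻¹ ^ 5 * t₁⁻¹) with hC₃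
  set C₆ := t₀⁻¹ ^ 3 * t₁⁻¹ ^ 6 + 3 * (t₀⁻¹ ^ 4 * t₁⁻¹ ^ 5) + 6 * (t₀⁻¹ ^ 5 * t₁⁻¹ ^ 4)
          + 10 * (t₀⁻¹ ^ 6 * t₁⁻¹ ^ 3) + 15 * (t₀⁻¹ ^ 7 * t₁⁻¹ ^ 2) + 21 * (t₀⁻¹ ^ 8 * t₁⁻¹) with hC₆
  -- the remainder equals `-(Δ³) · (C₆/12 - C₃/6)`
  have key : (1 / 12 * t₁⁻¹ ^ 6 - 1 / 6 * t₁⁻¹ ^ 3) - (1 / 12 * t₀⁻¹ ^ 6 - 1 / 6 * t₀⁻¹ ^ 3)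
        - (-(1 / 2) * t₀⁻¹ ^ 7 + 1 / 2 * t₀⁻¹ ^ 4) * (t₁ - t₀) - (7 / 4 * t₀⁻¹ ^ 8 - t₀⁻¹ ^ 5) * (t₁ - t₀) ^ 2
        = -((t₁ - t₀) ^ 3) * (1 / 12 * C₆ - 1 / 6 * C₃) := by
    linear_combination (1 / 12 : ℝ) * i6 - (1 / 6 : ℝ) * i3
  rw [key, abs_mul, abs_neg, abs_pow, mul_comm]
  refine mul_le_mul_of_nonneg_right ?_ (pow_nonneg (abs_nonneg _) 3)
  rw [abs_le]
  constructor
  · nlinarith [le_max_right (14 / 3 * ρ⁻¹ ^ 9) (5 / 3 * ρ⁻¹ ^ 6)]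
  · nlinarith [le_max_left (14 / 3 * ρ⁻¹ ^ 9) (5 / 3 * ρ⁻¹ ^ 6)]

/-! ## Bond part -/

variable {V : Type*} [NormedAddCommGroup V] [InnerProductSpace ℝ V]

/-- Exact bookkeeping with ARBITRARY scalars `a = φ₀, b = φ₁, c = φ′₀, d = φ″₀`: energy difference minus (first-order `(2c)⟪n,δ⟫`) minus (second-order
`c‖δ‖² + 2d⟪n,δ⟫²`) = scalar third-order remainder + explicit cubic/quartic terms. [folklore] -/
theorem bond_energy_expansion_eq (n δ : V) (a b c d : ℝ) :
    b - a - 2 * c * ⟪n, δ⟫ - (c * ‖δ‖ ^ 2 + 2 * d * ⟪n, δ⟫ ^ 2)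
      = (b - a - c * (‖n + δ‖ ^ 2 - ‖n‖ ^ 2) - d / 2 * (‖n + δ‖ ^ 2 - ‖n‖ ^ 2) ^ 2)
        + d * (2 * ⟪n, δ⟫ * ‖δ‖ ^ 2 + 1 / 2 * ‖δ‖ ^ 4) := by
  have hΔ : ‖n + δ‖ ^ 2 - ‖n‖ ^ 2 = 2 * ⟪n, δ⟫ + ‖δ‖ ^ 2 := by rw [norm_add_sq_real]; ring
  rw [hΔ]; ring

/-- Certificate socket: the bond remainder in terms of the scalar remainder `R₃` and `|d|`. [folklore] -/
theorem abs_bond_energy_remainder_le_of_scalars (n δ : V) (a b c d : ℝ) :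
    |b - a - 2 * c * ⟪n, δ⟫ - (c * ‖δ‖ ^ 2 + 2 * d * ⟪n, δ⟫ ^ 2)|
      ≤ |b - a - c * (‖n + δ‖ ^ 2 - ‖n‖ ^ 2) - d / 2 * (‖n + δ‖ ^ 2 - ‖n‖ ^ 2) ^ 2| + |d| * (2 * ‖n‖ * ‖δ‖ ^ 3 + 1 / 2 * ‖δ‖ ^ 4) := by
  rw [bond_energy_expansion_eq]
  refine (abs_add_le _ _).trans (add_le_add le_rfl ?_)
  rw [abs_mul]
  refine mul_le_mul_of_nonneg_left ?_ (abs_nonneg d)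
  have h := abs_real_inner_le_norm n δ
  have hδ := norm_nonneg δ
  have hn := norm_nonneg n
  calc |2 * ⟪n, δ⟫ * ‖δ‖ ^ 2 + 1 / 2 * ‖δ‖ ^ 4| ≤ |2 * ⟪n, δ⟫ * ‖δ‖ ^ 2| + |1 / 2 * ‖δ‖ ^ 4| := abs_add_le _ _
    _ = 2 * |⟪n, δ⟫| * ‖δ‖ ^ 2 + 1 / 2 * ‖δ‖ ^ 4 := by
        rw [abs_mul, abs_mul, abs_two, abs_of_nonneg (sq_nonneg ‖δ‖), abs_of_nonneg (by positivity : (0:ℝ) ≤ 1 / 2 * ‖δ‖ ^ 4)]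
    _ ≤ 2 * ‖n‖ * ‖δ‖ ^ 3 + 1 / 2 * ‖δ‖ ^ 4 := by nlinarith [sq_nonneg ‖δ‖, mul_le_mul_of_nonneg_right h (sq_nonneg ‖δ‖)]

/-- ★ **LJ bond-energy third-order remainder.**  With `t₀ = ‖n‖²`, `t₁ = ‖n + δ‖²`, `0 < ρ ≤ t₀, t₁`:
`|φ t₁ - φ t₀ - ψ t₀ ⟪n,δ⟫ - (φ′ t₀ ‖δ‖² + 2 φ″ t₀ ⟪n,δ⟫²)| ≤ max((14/3)ρ⁻¹^9, (5/3)ρ⁻¹^6) (2‖n‖‖δ‖ + ‖δ‖²)³ + |φ″ t₀| (2‖n‖‖δ‖³ + ½‖δ‖⁴)`,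
where `ψ = 2φ′ = t⁻¹^4 - t⁻¹^7` is NODE-10's force profile and `φ″ t = (7/2) t⁻¹^8 - 2 t⁻¹^5`. [folklore] -/
theorem abs_bond_energy_remainder_le (n δ : V) {ρ : ℝ} (hρ : 0 < ρ) (h₀ : ρ ≤ ‖n‖ ^ 2) (h₁ : ρ ≤ ‖n + δ‖ ^ 2) :
    |(1 / 12 * (‖n + δ‖ ^ 2)⁻¹ ^ 6 - 1 / 6 * (‖n + δ‖ ^ 2)⁻¹ ^ 3) - (1 / 12 * (‖n‖ ^ 2)⁻¹ ^ 6 - 1 / 6 * (‖n‖ ^ 2)⁻¹ ^ 3)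
        - 2 * (-(1 / 2) * (‖n‖ ^ 2)⁻¹ ^ 7 + 1 / 2 * (‖n‖ ^ 2)⁻¹ ^ 4) * ⟪n, δ⟫
        - ((-(1 / 2) * (‖n‖ ^ 2)⁻¹ ^ 7 + 1 / 2 * (‖n‖ ^ 2)⁻¹ ^ 4) * ‖δ‖ ^ 2
            + 2 * (7 / 2 * (‖n‖ ^ 2)⁻¹ ^ 8 - 2 * (‖n‖ ^ 2)⁻¹ ^ 5) * ⟪n, δ⟫ ^ 2)|
      ≤ max (14 / 3 * ρ⁻¹ ^ 9) (5 / 3 * ρ⁻¹ ^ 6) * (2 * ‖n‖ * ‖δ‖ + ‖δ‖ ^ 2) ^ 3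
        + |7 / 2 * (‖n‖ ^ 2)⁻¹ ^ 8 - 2 * (‖n‖ ^ 2)⁻¹ ^ 5| * (2 * ‖n‖ * ‖δ‖ ^ 3 + 1 / 2 * ‖δ‖ ^ 4) := by
  refine (abs_bond_energy_remainder_le_of_scalars n δ _ _ _ _).trans (add_le_add ?_ le_rfl)
  have hR := phi_taylor₃_abs_le hρ h₀ h₁
  have hΔ := abs_norm_add_sq_sub_le n δ
  have hM : 0 ≤ max (14 / 3 * ρ⁻¹ ^ 9) (5 / 3 * ρ⁻¹ ^ 6) :=
    le_max_of_le_left (mul_nonneg (by norm_num) (pow_nonneg (inv_nonneg.mpr hρ.le) 9))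
  have hΔ3 : |‖n + δ‖ ^ 2 - ‖n‖ ^ 2| ^ 3 ≤ (2 * ‖n‖ * ‖δ‖ + ‖δ‖ ^ 2) ^ 3 := pow_le_pow_left₀ (abs_nonneg _) hΔ 3
  have h2 : (7 / 2 * (‖n‖ ^ 2)⁻¹ ^ 8 - 2 * (‖n‖ ^ 2)⁻¹ ^ 5) / 2 = 7 / 4 * (‖n‖ ^ 2)⁻¹ ^ 8 - (‖n‖ ^ 2)⁻¹ ^ 5 := by ring
  rw [h2]
  exact hR.trans (mul_le_mul_of_nonneg_left hΔ3 hM)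

/-- The two-sided form T2 actually uses (a LOWER bound on the bond energy). [folklore] -/
theorem bond_energy_ge (n δ : V) {ρ : ℝ} (hρ : 0 < ρ) (h₀ : ρ ≤ ‖n‖ ^ 2) (h₁ : ρ ≤ ‖n + δ‖ ^ 2) :
    (1 / 12 * (‖n‖ ^ 2)⁻¹ ^ 6 - 1 / 6 * (‖n‖ ^ 2)⁻¹ ^ 3)
        + 2 * (-(1 / 2) * (‖n‖ ^ 2)⁻¹ ^ 7 + 1 / 2 * (‖n‖ ^ 2)⁻¹ ^ 4) * ⟪n, δ⟫
        + ((-(1 / 2) * (‖n‖ ^ 2)⁻¹ ^ 7 + 1 / 2 * (‖n‖ ^ 2)⁻¹ ^ 4) * ‖δ‖ ^ 2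
            + 2 * (7 / 2 * (‖n‖ ^ 2)⁻¹ ^ 8 - 2 * (‖n‖ ^ 2)⁻¹ ^ 5) * ⟪n, δ⟫ ^ 2)
        - (max (14 / 3 * ρ⁻¹ ^ 9) (5 / 3 * ρ⁻¹ ^ 6) * (2 * ‖n‖ * ‖δ‖ + ‖δ‖ ^ 2) ^ 3
            + |7 / 2 * (‖n‖ ^ 2)⁻¹ ^ 8 - 2 * (‖n‖ ^ 2)⁻¹ ^ 5| * (2 * ‖n‖ * ‖δ‖ ^ 3 + 1 / 2 * ‖δ‖ ^ 4))
      ≤ 1 / 12 * (‖n + δ‖ ^ 2)⁻¹ ^ 6 - 1 / 6 * (‖n + δ‖ ^ 2)⁻¹ ^ 3 := by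
  have h := abs_bond_energy_remainder_le n δ hρ h₀ h₁
  rw [abs_le] at h
  linarith [h.1]

end Summit.AtomisticToContinuum.Crystallization.Theorems.FrustratedLawDichotomyEnergyRemainder
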